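import Mathlib
import Summits.Ventures.PercRepro2.PMK5Deg3Kernel
import Summits.Ventures.PercRepro2.Deg3Kron
import Summits.Ventures.PercRepro2.Deg3Digits
import Summits.Ventures.PercRepro2.Deg3Tables
import Summits.Ventures.PercRepro2.Deg3Bits

/-!
# The slice decomposition: thirteen-edge triple counts are sums of eleven-edge counts of restricted tables
(blind cell PercRepro2, mine-2 g27; the bridge between the slice certificates of `PMK5Deg3Kernel.lean` and
the typed counts of `K₃` on `K₅ + {a₃x, a₃y, a₃z}`)

* `resL`, `prof_snoc_iff`, `snoc3`, **`cnt3n_succ`**: restricting the last edge — a triple count on `n + 1`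
  edges is the sum, over the three ways `(a, b, c)` to split the last profile digit into bits (`splits3`), of
  the triple counts of the restricted tables on `n` edges;
* `ext2_eq`, `res2_eq`, **`cnt3n_thirteen`**: applied twice (edges `12` then `11`), the thirteen-edge count of
  a monomial is the nested list sum of eleven-edge counts of `res2`-restricted tables — the slice counts
  `cntSlice`, `cntPosS`, `cntNegS`, and `cntPos13_eq`, `cntNeg13_eq`;
* `kSlice_eq`, `kPosU_eq`, `kNegU_eq`: the ungrouped slice numbers are the Kronecker sums of the slice counts;
  `kPosS_eq_kPosU`, `kNegS_eq_kNegU`: the grouped slice numbers of the kernel file equal the ungrouped ones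
  (sixteen cases, `ring`);
* `cntPosS_lt`, `cntNegS_lt`: the slice counts are below `KB` (at most `10 · 9` counts `≤ 3^11`);
* **`cntNegS_le_cntPosS`**: a slice certificate `CertS x y z j₁ j₂` gives `cntNegS ≤ cntPosS` at every
  eleven-edge profile, by the digit bridge `le_of_kron_le'`.
-/

namespace Summit.Ventures.PercRepro2

open Hub

namespace Deg3

/-! ## Restricting the last edge -/

section Generic

variable {n : ℕ}

/-- The restriction of a table on `n + 1` edges to the first `n`, the last edge in the state `a`. -/
def resL (T : (Fin (n + 1) → Bool) → Bool) (a : Bool) : (Fin n → Bool) → Bool :=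
  fun ω => T (Fin.snoc ω a)

/-- The profile of three `snoc`s is `k` iff the initial profile is the initial part of `k` and the three last
bits sum to the last digit. -/
lemma prof_snoc_iff (w₁ w₂ w₃ : Fin n → Bool) (a b c : Bool) (k : Fin (n + 1) → Fin 4) :
    prof (Fin.snoc w₁ a) (Fin.snoc w₂ b) (Fin.snoc w₃ c) = k ↔
      prof w₁ w₂ w₃ = (fun i => k i.castSucc) ∧
        (a.toNat + b.toNat + c.toNat : ℕ) = k (Fin.last n) := by
  constructor
  · intro h
    refine ⟨funext fun i => ?_, ?_⟩
    · have := congrFun h i.castSucc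
      apply Fin.ext
      rw [← this, prof_apply, prof_apply]
      simp only [Fin.snoc_castSucc]
    · have := congrFun h (Fin.last n)
      rw [← this, prof_apply]
      simp only [Fin.snoc_last]
  · rintro ⟨h1, h2⟩
    funext i
    induction i using Fin.lastCases with
    | last =>
      apply Fin.ext
      rw [prof_apply]
      simp only [Fin.snoc_last]
      exact h2
    | cast i =>
      have := congrFun h1 i
      apply Fin.ext
      rw [prof_apply]
      simp only [Fin.snoc_castSucc]
      rw [← prof_apply, this]

/-- A sum over the three bits of an `if` on their sum is a list sum over `splits3`. -/
lemma sum_bool3_eq_splits (j : Fin 4) (g : Bool × Bool × Bool → ℕ) :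
    (∑ abc : Bool × Bool × Bool,
        if (abc.1.toNat + abc.2.1.toNat + abc.2.2.toNat : ℕ) = j then g abc else 0) =
      ((splits3 j).map g).sum := by
  fin_cases j <;> simp [Fintype.sum_prod_type, splits3]
  ring

/-- Triples of `(n+1)`-configurations as triples of `n`-configurations and three last bits. -/
def snoc3 : ((Fin n → Bool) × (Fin n → Bool) × (Fin n → Bool)) × (Bool × Bool × Bool) ≃
    (Fin (n + 1) → Bool) × (Fin (n + 1) → Bool) × (Fin (n + 1) → Bool) where
  toFun p := (Fin.snoc p.1.1 p.2.1, Fin.snoc p.1.2.1 p.2.2.1, Fin.snoc p.1.2.2 p.2.2.2)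
  invFun t := ((Fin.init t.1, Fin.init t.2.1, Fin.init t.2.2),
    (t.1 (Fin.last n), t.2.1 (Fin.last n), t.2.2 (Fin.last n)))
  left_inv p := by simp [Fin.init_snoc, Fin.snoc_last]
  right_inv t := by simp [Fin.snoc_init_self]

/-- **Restricting the last edge**: a triple count on `n + 1` edges is the sum over the splits of the last
digit of the triple counts of the restricted tables. -/
theorem cnt3n_succ (T₁ T₂ T₃ : (Fin (n + 1) → Bool) → Bool) (k : Fin (n + 1) → Fin 4) :
    cnt3n T₁ T₂ T₃ k = ((splits3 (k (Fin.last n))).map fun abc =>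
      cnt3n (resL T₁ abc.1) (resL T₂ abc.2.1) (resL T₃ abc.2.2) (fun i => k i.castSucc)).sum := by
  rw [← sum_bool3_eq_splits]
  unfold cnt3n
  rw [Finset.sum_filter, ← Equiv.sum_comp snoc3, Fintype.sum_prod_type, Finset.sum_comm]
  refine Finset.sum_congr rfl fun abc _ => ?_
  simp only [snoc3, Equiv.coe_fn_mk, prof_snoc_iff]
  by_cases h : (abc.1.toNat + abc.2.1.toNat + abc.2.2.toNat : ℕ) = k (Fin.last n)
  · simp only [h, and_true, if_true, Finset.sum_filter]
    rfl
  · simp only [h, and_false, if_false, Finset.sum_const_zero]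

end Generic

/-! ## The two `a₃`-edges `11`, `12` of the thirteen-edge graph -/

/-- `ext2` is `snoc` twice. -/
lemma ext2_eq (ω : Fin 11 → Bool) (a b : Bool) : ext2 ω a b = Fin.snoc (Fin.snoc ω a) b := by
  funext e
  induction e using Fin.lastCases with
  | last => rw [Fin.snoc_last]; rfl
  | cast e =>
    induction e using Fin.lastCases with
    | last => rw [Fin.snoc_castSucc, Fin.snoc_last]; rfl
    | cast e => rw [Fin.snoc_castSucc, Fin.snoc_castSucc]; simp [ext2]

/-- `res2` is the restriction of edge `12` then of edge `11`. -/
lemma res2_eq (T : (Fin 13 → Bool) → Bool) (a b : Bool) : res2 T a b = resL (resL T b) a := by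
  funext ω
  simp [res2, resL, ext2_eq]

/-- **The two-step decomposition**: a thirteen-edge triple count is the nested list sum, over the splits of
the digits of edges `12` and `11`, of eleven-edge counts of the `res2`-restricted tables. -/
theorem cnt3n_thirteen (T₁ T₂ T₃ : (Fin 13 → Bool) → Bool) (k : Fin 13 → Fin 4) :
    cnt3n T₁ T₂ T₃ k = ((splits3 (k 12)).map fun s₂ => ((splits3 (k 11)).map fun s₁ =>
      cnt3 (res2 T₁ s₁.1 s₂.1) (res2 T₂ s₁.2.1 s₂.2.1) (res2 T₃ s₁.2.2 s₂.2.2)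
        (fun i => k i.castSucc.castSucc)).sum).sum := by
  rw [cnt3n_succ]
  have h12 : k (Fin.last 12) = k 12 := rfl
  rw [h12]
  refine congrArg List.sum (List.map_congr_left fun s₂ _ => ?_)
  rw [cnt3n_succ]
  have h11 : k (Fin.last 11).castSucc = k 11 := rfl
  rw [h11]
  refine congrArg List.sum (List.map_congr_left fun s₁ _ => ?_)
  rw [cnt3n_eq_cnt3, res2_eq, res2_eq, res2_eq]

/-! ## The monomials and the slice counts -/

/-- The ten positive monomials of `K₃` as triples of table indices (`tab`: `0 Q, 1 PD, 2 PDoU, 3 t4p, 5 t5p,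
8 t6m, 9 t7p4, 10 t7m4, 11 t7p0, 12 t7m0, 13 t7p5, 14 t7m5, 15 t10p, 16 t10m, 18 t12`), in the order `x, y, w`
of `kPos`. -/
def posMonos : List (Fin 19 × Fin 19 × Fin 19) :=
  [(1, 0, 3), (0, 2, 5), (1, 0, 8), (1, 9, 12), (1, 10, 11), (2, 9, 14), (2, 10, 13), (1, 9, 15), (1, 10, 16),
    (0, 18, 2)]

/-- The ten negative monomials of `K₃` as triples of table indices (`4 t4m, 6 t5m, 7 t6p, 17 t11`). -/
def negMonos : List (Fin 19 × Fin 19 × Fin 19) :=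
  [(1, 0, 4), (0, 2, 6), (1, 0, 7), (1, 9, 11), (1, 10, 12), (2, 9, 13), (2, 10, 14), (1, 9, 16), (1, 10, 15),
    (1, 0, 17)]

/-- The slice count of a monomial at the eleven-edge profile `k` (digits `j₁`, `j₂` on edges `11`, `12`). -/
def cntSlice (x y z : Fin 5) (M : Fin 19 × Fin 19 × Fin 19) (j₁ j₂ : ℕ) (k : Fin 11 → Fin 4) : ℕ :=
  ((splits3 j₂).map fun s₂ => ((splits3 j₁).map fun s₁ =>
    cnt3 (res2 (tab x y z M.1) s₁.1 s₂.1) (res2 (tab x y z M.2.1) s₁.2.1 s₂.2.1)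
      (res2 (tab x y z M.2.2) s₁.2.2 s₂.2.2) k).sum).sum

/-- The ungrouped slice number of a monomial, from the literals. -/
def kSlice (L : Fin 19 → Bool → Bool → ℕ) (M : Fin 19 × Fin 19 × Fin 19) (j₁ j₂ : ℕ) : ℕ :=
  ((splits3 j₂).map fun s₂ => ((splits3 j₁).map fun s₁ =>
    KL L M.1 s₁.1 s₂.1 * KL L M.2.1 s₁.2.1 s₂.2.1 * KL L M.2.2 s₁.2.2 s₂.2.2).sum).sum

/-- The positive slice counts. -/
def cntPosS (x y z : Fin 5) (j₁ j₂ : ℕ) (k : Fin 11 → Fin 4) : ℕ :=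
  (posMonos.map fun M => cntSlice x y z M j₁ j₂ k).sum

/-- The negative slice counts. -/
def cntNegS (x y z : Fin 5) (j₁ j₂ : ℕ) (k : Fin 11 → Fin 4) : ℕ :=
  (negMonos.map fun M => cntSlice x y z M j₁ j₂ k).sum

/-- The ungrouped positive slice number. -/
def kPosU (L : Fin 19 → Bool → Bool → ℕ) (j₁ j₂ : ℕ) : ℕ := (posMonos.map fun M => kSlice L M j₁ j₂).sum

/-- The ungrouped negative slice number. -/
def kNegU (L : Fin 19 → Bool → Bool → ℕ) (j₁ j₂ : ℕ) : ℕ := (negMonos.map fun M => kSlice L M j₁ j₂).sum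

/-- The positive thirteen-edge counts of `K₃`. -/
def cntPos13 (x y z : Fin 5) (k : Fin 13 → Fin 4) : ℕ :=
  (posMonos.map fun M => cnt3n (tab x y z M.1) (tab x y z M.2.1) (tab x y z M.2.2) k).sum

/-- The negative thirteen-edge counts of `K₃`. -/
def cntNeg13 (x y z : Fin 5) (k : Fin 13 → Fin 4) : ℕ :=
  (negMonos.map fun M => cnt3n (tab x y z M.1) (tab x y z M.2.1) (tab x y z M.2.2) k).sum

/-- The eleven-edge part of a thirteen-edge profile. -/
def restr (k : Fin 13 → Fin 4) : Fin 11 → Fin 4 := fun i => k i.castSucc.castSucc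

/-- The positive thirteen-edge counts are the slice counts at the profile's two last digits. -/
lemma cntPos13_eq (x y z : Fin 5) (k : Fin 13 → Fin 4) :
    cntPos13 x y z k = cntPosS x y z (k 11) (k 12) (restr k) := by
  unfold cntPos13 cntPosS cntSlice restr
  simp only [cnt3n_thirteen]

/-- The negative thirteen-edge counts are the slice counts at the profile's two last digits. -/
lemma cntNeg13_eq (x y z : Fin 5) (k : Fin 13 → Fin 4) :
    cntNeg13 x y z k = cntNegS x y z (k 11) (k 12) (restr k) := by
  unfold cntNeg13 cntNegS cntSlice restr
  simp only [cnt3n_thirteen]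

/-! ## The slice numbers are the Kronecker sums of the slice counts -/

/-- A list sum of finite sums is a finite sum of list sums. -/
lemma listSum_finsetSum {α β : Type*} (l : List α) (s : Finset β) (f : α → β → ℕ) :
    (l.map fun a => ∑ b ∈ s, f a b).sum = ∑ b ∈ s, (l.map fun a => f a b).sum := by
  induction l with
  | nil => simp
  | cons a l ih => simp [List.map_cons, List.sum_cons, ih, Finset.sum_add_distrib]

/-- The ungrouped slice number of a monomial is the Kronecker sum of its slice counts (correct literals). -/
lemma kSlice_eq (x y z : Fin 5) {L : Fin 19 → Bool → Bool → ℕ} (hL : LitOK x y z L)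
    (M : Fin 19 × Fin 19 × Fin 19) (j₁ j₂ : ℕ) :
    kSlice L M j₁ j₂ = ∑ k, cntSlice x y z M j₁ j₂ k * KB ^ idx4 k := by
  unfold kSlice cntSlice
  simp only [KL_eq x y z hL, kron_eq_kronSum, kronSum_mul_mul, listSum_finsetSum, List.sum_map_mul_right]

/-- The ungrouped positive slice number is the Kronecker sum of the positive slice counts. -/
lemma kPosU_eq (x y z : Fin 5) {L : Fin 19 → Bool → Bool → ℕ} (hL : LitOK x y z L) (j₁ j₂ : ℕ) :
    kPosU L j₁ j₂ = ∑ k, cntPosS x y z j₁ j₂ k * KB ^ idx4 k := by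
  unfold kPosU cntPosS
  simp only [kSlice_eq x y z hL, listSum_finsetSum, List.sum_map_mul_right]

/-- The ungrouped negative slice number is the Kronecker sum of the negative slice counts. -/
lemma kNegU_eq (x y z : Fin 5) {L : Fin 19 → Bool → Bool → ℕ} (hL : LitOK x y z L) (j₁ j₂ : ℕ) :
    kNegU L j₁ j₂ = ∑ k, cntNegS x y z j₁ j₂ k * KB ^ idx4 k := by
  unfold kNegU cntNegS
  simp only [kSlice_eq x y z hL, listSum_finsetSum, List.sum_map_mul_right]

/-- A list sum of list sums commutes. -/
lemma listSum_map_sum_comm {α β : Type*} (l : List α) (l' : List β) (f : α → β → ℕ) :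
    (l.map fun a => (l'.map fun b => f a b).sum).sum = (l'.map fun b => (l.map fun a => f a b).sum).sum := by
  induction l with
  | nil => simp
  | cons a l ih => simp only [List.map_cons, List.sum_cons, ih, ← List.sum_map_add]

/-- The sum over the splittings of a digit, as a sum over the first bit and the completing pair. -/
lemma splits3_eq_pairs (g : Bool × Bool × Bool → ℕ) : ∀ j : ℕ,
    ((splits3 j).map g).sum = (bools.map fun a => ((pairs2 j a).map fun bc => g (a, bc.1, bc.2)).sum).sum
  | 0 => by simp [splits3, pairs2, bools]
  | 1 => by simp [splits3, pairs2, bools]; ring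
  | 2 => by simp [splits3, pairs2, bools]; ring
  | 3 => by simp [splits3, pairs2, bools]
  | j + 4 => by
    have h1 : splits3 (j + 4) = [] := rfl
    have h2 : ∀ a, pairs2 (j + 4) a = [] := fun a => by cases a <;> rfl
    simp [h1, h2, bools]

/-- **The grouped positive slice number of the kernel file is the ungrouped one** — an identity between sums
of products of the literal Kronecker numbers, uniform in the slice: the splittings are re-summed by the first
factor's bits, the monomial sum is pushed innermost, and the ten monomials are regrouped by `ring`. -/
lemma kPosS_eq_kPosU (L : Fin 19 → Bool → Bool → ℕ) (j₁ j₂ : ℕ) : kPosS L j₁ j₂ = kPosU L j₁ j₂ := by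
  unfold kPosU kSlice
  simp only [splits3_eq_pairs]
  rw [listSum_map_sum_comm posMonos bools]
  simp only [listSum_map_sum_comm posMonos (pairs2 _ _), listSum_map_sum_comm posMonos bools]
  simp only [listSum_map_sum_comm (pairs2 _ _) bools]
  simp only [posMonos, List.map_cons, List.map_nil, List.sum_cons, List.sum_nil, add_zero]
  unfold kPosS inner
  simp only [← List.sum_map_mul_left, ← List.sum_map_add]
  refine congrArg List.sum (List.map_congr_left fun a₂ _ => congrArg List.sum (List.map_congr_left fun a₁ _ =>
    congrArg List.sum (List.map_congr_left fun bc₂ _ => congrArg List.sum (List.map_congr_left fun bc₁ _ => ?_))))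
  simp only [brPosPD, brPosPDoU, brPosQ, S1, S2, S3]
  ring

/-- **The grouped negative slice number of the kernel file is the ungrouped one.** -/
lemma kNegS_eq_kNegU (L : Fin 19 → Bool → Bool → ℕ) (j₁ j₂ : ℕ) : kNegS L j₁ j₂ = kNegU L j₁ j₂ := by
  unfold kNegU kSlice
  simp only [splits3_eq_pairs]
  rw [listSum_map_sum_comm negMonos bools]
  simp only [listSum_map_sum_comm negMonos (pairs2 _ _), listSum_map_sum_comm negMonos bools]
  simp only [listSum_map_sum_comm (pairs2 _ _) bools]
  simp only [negMonos, List.map_cons, List.map_nil, List.sum_cons, List.sum_nil, add_zero]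
  unfold kNegS inner
  simp only [← List.sum_map_mul_left, ← List.sum_map_add]
  refine congrArg List.sum (List.map_congr_left fun a₂ _ => congrArg List.sum (List.map_congr_left fun a₁ _ =>
    congrArg List.sum (List.map_congr_left fun bc₂ _ => congrArg List.sum (List.map_congr_left fun bc₁ _ => ?_))))
  simp only [brNegPD, brNegPDoU, brNegQ, S1', S2', S3']
  ring

/-! ## The slice counts are below `KB` -/

/-- A list sum of values `≤ B` is at most `length · B`. -/
lemma sum_map_le {α : Type*} (l : List α) (f : α → ℕ) (B : ℕ) (h : ∀ a ∈ l, f a ≤ B) :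
    (l.map f).sum ≤ l.length * B := by
  induction l with
  | nil => simp
  | cons a l ih =>
    simp only [List.map_cons, List.sum_cons, List.length_cons]
    have h1 := h a List.mem_cons_self
    have h2 := ih fun a ha => h a (List.mem_cons.2 (Or.inr ha))
    rw [Nat.succ_mul]
    omega

/-- `splits3 j` has at most three entries. -/
lemma splits3_length_le : ∀ j : ℕ, (splits3 j).length ≤ 3
  | 0 => by decide
  | 1 => by decide
  | 2 => by decide
  | 3 => by decide
  | _ + 4 => Nat.zero_le _

/-- A slice count of a monomial is at most `9 · 3^11`. -/
lemma cntSlice_le (x y z : Fin 5) (M : Fin 19 × Fin 19 × Fin 19) (j₁ j₂ : ℕ) (k : Fin 11 → Fin 4) :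
    cntSlice x y z M j₁ j₂ k ≤ 9 * 177147 := by
  unfold cntSlice
  have hin : ∀ s₂ ∈ splits3 j₂, ((splits3 j₁).map fun s₁ =>
      cnt3 (res2 (tab x y z M.1) s₁.1 s₂.1) (res2 (tab x y z M.2.1) s₁.2.1 s₂.2.1)
        (res2 (tab x y z M.2.2) s₁.2.2 s₂.2.2) k).sum ≤ 3 * 177147 := by
    intro s₂ _
    refine (sum_map_le _ _ 177147 fun s₁ _ => cnt3_le _ _ _ _).trans ?_
    exact Nat.mul_le_mul_right _ (splits3_length_le j₁)
  refine (sum_map_le _ _ (3 * 177147) hin).trans ?_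
  have := splits3_length_le j₂
  calc (splits3 j₂).length * (3 * 177147) ≤ 3 * (3 * 177147) := Nat.mul_le_mul_right _ this
    _ = 9 * 177147 := by norm_num

/-- `KB = 16777216`. -/
lemma KB_val : KB = 16777216 := by rw [KB_eq]; norm_num

/-- The positive slice counts are below `KB = 2^24` (ten monomials, `10 · 9 · 3^11 = 15943230`). -/
lemma cntPosS_lt (x y z : Fin 5) (j₁ j₂ : ℕ) (k : Fin 11 → Fin 4) : cntPosS x y z j₁ j₂ k < KB := by
  unfold cntPosS
  have h := sum_map_le posMonos (fun M => cntSlice x y z M j₁ j₂ k) (9 * 177147)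
    fun M _ => cntSlice_le x y z M j₁ j₂ k
  have hl : posMonos.length = 10 := rfl
  rw [hl] at h
  rw [KB_val]
  omega

/-- The negative slice counts are below `KB`. -/
lemma cntNegS_lt (x y z : Fin 5) (j₁ j₂ : ℕ) (k : Fin 11 → Fin 4) : cntNegS x y z j₁ j₂ k < KB := by
  unfold cntNegS
  have h := sum_map_le negMonos (fun M => cntSlice x y z M j₁ j₂ k) (9 * 177147)
    fun M _ => cntSlice_le x y z M j₁ j₂ k
  have hl : negMonos.length = 10 := rfl
  rw [hl] at h
  rw [KB_val]
  omega

/-! ## The slice certificate read digit by digit -/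

/-- **A slice certificate bounds the negative slice counts by the positive ones** at every eleven-edge
profile. -/
theorem cntNegS_le_cntPosS (x y z : Fin 5) {L : Fin 19 → Bool → Bool → ℕ} (hL : LitOK x y z L) {j₁ j₂ : ℕ}
    (hc : CertS L j₁ j₂) (k : Fin 11 → Fin 4) :
    cntNegS x y z j₁ j₂ k ≤ cntPosS x y z j₁ j₂ k :=
  le_of_kron_le' (cntPosS x y z j₁ j₂) (cntNegS x y z j₁ j₂) (cntPosS_lt x y z j₁ j₂)
    (cntNegS_lt x y z j₁ j₂) ((kPosS_eq_kPosU L j₁ j₂).trans (kPosU_eq x y z hL j₁ j₂))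
    ((kNegS_eq_kNegU L j₁ j₂).trans (kNegU_eq x y z hL j₁ j₂)) hc.1 hc.2.1 hc.2.2 k

end Deg3

end Summit.Ventures.PercRepro2
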